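import Summits.QuantumFields.BalabanUV.Beta.GAN24.StencilSlotLamDrift
import Summits.QuantumFields.BalabanUV.Beta.GAN24.KSlotAssembly

/-!
# `BalabanUV.Beta.GAN24.ContactTentCauchy` — binder row G-an2-4 ∕ (CONV-C), the row owner's CONTACT-TERM ROUTE, `gen19/CT4-DESIGN-v0.md` §2 (γ)∕(γ′)
# and §3 «CT-4d `ContactTentCauchy` → gan24-p2∕p3 (K-slot owners)»: **THE TENT's UNIT MULTIPLIER KERNEL `N^{2(d+1)}·wΦ_N` (`N = Lc^{k+1}`)
# IS — UP TO THE `k`-FREE FACTOR `Lc^{2(d+1)}` — THE ff-BLOCK OF THE RESCALED VALUE HESSIAN `(s_m k)²•E2 (k+1)`, i.e. THE mm-BLOCK OF THE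
# UNIT-NORMALISED STEP RESOLVENT `KStepUnit Lc k` AT COARSE POINTS; HENCE ITS LEVEL-UNIFORM DECAY IS `hK` AND ITS ALL-SCALES CAUCHY LETTER
# IS `hKall` READ ON THE mm-BLOCK** — both TREE at `d = 3` (`KSlotAssembly.convCKWall_holds`), so (γ)'s kernel letter costs NO new analytic input

NOT IN PRINT; OUR PROOF ATTEMPT (unit `b2b-balaban-gan24-p2`, gen 32 = prover-b2b-balaban-gan24-p2-g32-0, road-P2 chair of row G-an2-4 = one of the
two «K-slot owners» the design names; CRUX TEAM (2) under the ruling «YM REDIRECT TOWARDS THE SUMMIT», 2026-08-21; «MINE» journal `CLAIMS.log` l.33081).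
HONEST FRAMING (cell contract, verbatim): «discharging `BetaPertH` makes Bałaban's UV stability UNCONDITIONAL — a real constructive-QFT result; it is
NOT the continuum limit and NOT the Clay problem.»  HONEST DEPENDENCY (verbatim): «continuum YM on T⁴ ⇐ BetaPertH ∧ nine spine estimates (0/9 proved);
BetaPertH ⇐ (D1) ∧ (D4) ∧ CAP+tail; G-an2-4 gates asym, D1 and NE2/3/4.»  ABSOLUTE RULE: nothing printed is a hypothesis; no `def … : Prop`, no
`sorry`, 0 `def`; [folklore] dictionary + bookkeeping BY NAME over an2's `BalabanStepJetsSucc.E2` ∕ `mmRead_inl_inl`, an5∕d4-p3's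
`OneStepResolventKernel.KInv_inr_inr_coarse`, road P1's `StencilSlotLam.decays_E2unit` ∕ `StencilSlotLamDrift.decays_E2unit_sub` (the `E″`-dictionary
`E2_succ_inl_inl`) and `KSlotAssembly.convCKWall_holds` (`d = 3`).  The K-slot data enter §2 as HYPOTHESES (`UnitDecayK`, `CauchyDecayK` — the wall's
`hK`∕`hKall` in the adopted units) and are DISCHARGED in §3 at `d = 3` only.

## The located check (γ′) — the exact indexing (generic `d`, every `Lc` with `NeZero Lc`)
 * `wΦ_eq_E2`: `wΦ (N := Lc^j) κ l (z − u) = E2 d Lc j z u (inl κ) (inl l)` — leaf-01 g58's tent kernel `φ_{μ,z} κ y := wΦ κ μ (y − z)`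
   (`ContactPartnerLetters`, tower `k`, `N = Lc^{k+1}`, vertex level `m = 0`) is the ff-block of an2's value Hessian `E2 (k+1)`; `wΦ_eq_E2_zero` (`u = 0`).
 * `unitTent_eq`: `(Lc^{k+1})^{2(d+1)}·wΦ_{Lc^{k+1}} κ l y = Lc^{2(d+1)} · ((smStep d Lc k)² • E2 d Lc (k+1)) y 0 (inl κ) (inl l)` — the partner letters' unit
   `N^{2(d+1)}` (`= N^8` at `d = 3`, `ContactPartnerLetters.exists_partner_letters`' `(Lc^{8(k+1)})⁻¹`) against the K-slot's mm unit `(s_m k)² = (Lc^k)^{2(d+1)}`: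
   the mismatch is the `k`-FREE constant `Lc^{2(d+1)}` (the design's «up to the constant `Lc^{2(d+1)}`»), so NO power of `Lc` per level is lost (attack surface (iii)).
## (γ), kernel level (generic `d`, from the K-slot data as hypotheses)
 * `abs_unitTent_le`: `hK ⇒ |(Lc^{k+1})^{2(d+1)}·wΦ_{Lc^{k+1}} κ l y| ≤ Lc^{2(d+1)}·C·e^{−δ|y|₁}` for every `k` (level-uniform decay of the unit tent kernel).
 * **`abs_unitTent_sub_le`**: `hKall ⇒ |(Lc^{k+j+1})^{2(d+1)}·wΦ_{Lc^{k+j+1}} κ l y − (Lc^{k+1})^{2(d+1)}·wΦ_{Lc^{k+1}} κ l y| ≤ Lc^{2(d+1)}·cK·θ^k·e^{−δ|y|₁}` for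
   all `k, j` — THE ALL-SCALES CAUCHY LETTER OF THE UNIT TENT KERNEL at the SAME coarse displacement `y` (towers `k` and `k+j` have the same unit lattice).
 * translated forms `abs_unitTent_transl_le` ∕ `abs_unitTent_transl_sub_le` in the partner letters' variables (`φ_{μ,z} κ y = wΦ κ μ (y − z)`, decay in `|y − z|₁`).
## `d = 3`, UNCONDITIONAL (`Lc ≥ 2`)
 * **`exists_unitTent_letters_three`**: `∃ C δ cK θ`, `0 < δ`, `0 ≤ θ < 1`, with BOTH letters for all `k j μ z κ y` — `KSlotAssembly.convCKWall_holds` BY NAME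
   (rate `θ = √(Lc⁻²)`-class from `FibreRate.realRateK`, decay `δ_K∕2`; constants not displayed beyond the tree's).
WHAT THIS IS NOT.  Not (γ) at the TENT-FORCE level `𝒬ᵀ_{N′}φ′` vs `𝒬ᵀ_N φ` (the two towers' `𝒬ᵀ` live on different fine lattices — that comparison is
the cell-refinement schema CT-4c's, which consumes THIS kernel letter summed over a cell); not CT-4b∕c∕e; discharges NOTHING of (hS, hSall, hSdev) on (E);
0 wall binders; `ℓ¹` decay currency (stronger than the partner letters' `‖·‖∞` since `‖y‖∞ ≤ |y|₁`); NEVER «G-an2-4 closed»; NOT D1, NOT BetaPertH,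
NOT continuum, NOT Clay.  Text locations only: [Balaban1987RG1] (1.20)–(1.22) p. 264 (the effective actions whose Hessians `E2 j` reads); [King1986] §4 p. 672.
-/

noncomputable section

open Literature.MathematicalPhysics.QuantumFieldTheory
open Literature.MathematicalPhysics.QuantumFieldTheory.Balaban1983to89
open Literature.MathematicalPhysics.QuantumFieldTheory.Balaban1983to89.Beta
open B12Sec2to5 (l1 l1_nonneg)
open ExpKernelCalculus (Decays)
open OneStepResolventKernel (Fib KInv KInv_inr_inr_coarse)
open KernelSpecInstance (wΦ)
open BalabanStepJetsSucc (E2 mmRead_inl_inl)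
open Summit.QuantumFields.BalabanUV.Beta.GAN24.CombesThomas (sfStep smStep KStepUnit UnitDecayK CauchyDecayK ConvCKWall)
open Summit.QuantumFields.BalabanUV.Beta.GAN24.StencilSlotLam (decays_E2unit)
open Summit.QuantumFields.BalabanUV.Beta.GAN24.StencilSlotLamDrift (decays_E2unit_sub)
open Summit.QuantumFields.BalabanUV.Beta.GAN24.KSlotAssembly (convCKWall_holds)

namespace Summit.QuantumFields.BalabanUV.Beta.GAN24.ContactTentCauchy

variable {d : ℕ} {Lc : ℕ} [NeZero Lc]

/-! ## §1 (γ′) The dictionary: the tent kernel is the ff-block of an2's value Hessian -/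

section Dictionary

/-- **(γ′) THE TENT KERNEL IS `E2`**: `wΦ (N := Lc^j) κ l (z − u) = E2 d Lc j z u (inl κ) (inl l)` — the multiplier–multiplier block of the packed resolvent of
the `j`-fold composite read at the coarse points (`mmRead_inl_inl` + `KInv_inr_inr_coarse`). [folklore] -/
theorem wΦ_eq_E2 (j : ℕ) (κ l : Fin (d + 1)) (z u : Fin (d + 1) → ℤ) :
    wΦ (N := Lc ^ j) κ l (z - u) = E2 d Lc j z u (Sum.inl κ) (Sum.inl l) := by
  rw [E2, mmRead_inl_inl, KInv_inr_inr_coarse]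

/-- the same at `u = 0`: `wΦ (N := Lc^j) κ l y = E2 d Lc j y 0 (inl κ) (inl l)`. [folklore] -/
theorem wΦ_eq_E2_zero (j : ℕ) (κ l : Fin (d + 1)) (y : Fin (d + 1) → ℤ) :
    wΦ (N := Lc ^ j) κ l y = E2 d Lc j y 0 (Sum.inl κ) (Sum.inl l) := by
  rw [← wΦ_eq_E2, sub_zero]

/-- **THE UNITS**: `(Lc^{k+1})^{2(d+1)}·wΦ_{Lc^{k+1}} κ l y = Lc^{2(d+1)} · ((s_m k)² • E2 (k+1)) y 0 (inl κ) (inl l)` with `s_m k = smStep d Lc k = Lc^{k(d+1)}` — the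
partner letters' unit `N^{2(d+1)}` against the K-slot's mm unit; the mismatch `Lc^{2(d+1)}` is `k`-FREE. [folklore] -/
theorem unitTent_eq (k : ℕ) (κ l : Fin (d + 1)) (y : Fin (d + 1) → ℤ) :
    (((Lc : ℝ) ^ (k + 1)) ^ (2 * (d + 1))) * wΦ (N := Lc ^ (k + 1)) κ l y
      = (Lc : ℝ) ^ (2 * (d + 1)) * ((smStep d Lc k) ^ 2 • E2 d Lc (k + 1)) y 0 (Sum.inl κ) (Sum.inl l) := by
  rw [Pi.smul_apply, Pi.smul_apply, Pi.smul_apply, Pi.smul_apply, smul_eq_mul, ← wΦ_eq_E2_zero, smStep, ← mul_assoc]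
  congr 1
  rw [← pow_mul, ← pow_mul, ← pow_add]
  congr 1
  ring

end Dictionary

/-! ## §2 (γ) at the kernel level, from the K-slot data -/

section Letters

/-- **LEVEL-UNIFORM DECAY OF THE UNIT TENT KERNEL FROM `hK`**: `UnitDecayK … C δ` (`0 ≤ δ`) gives
`|(Lc^{k+1})^{2(d+1)}·wΦ_{Lc^{k+1}} κ l y| ≤ Lc^{2(d+1)}·C·e^{−δ|y|₁}` for every `k`. [folklore] -/
theorem abs_unitTent_le {C δ : ℝ} (hK : UnitDecayK d Lc (sfStep Lc) (smStep d Lc) C δ) (hδ : 0 ≤ δ) (k : ℕ) (κ l : Fin (d + 1))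
    (y : Fin (d + 1) → ℤ) :
    |(((Lc : ℝ) ^ (k + 1)) ^ (2 * (d + 1))) * wΦ (N := Lc ^ (k + 1)) κ l y| ≤ (Lc : ℝ) ^ (2 * (d + 1)) * C * Real.exp (-δ * l1 y) := by
  have h := decays_E2unit (hK k) hδ y 0 (Sum.inl κ) (Sum.inl l)
  rw [sub_zero] at h
  rw [unitTent_eq, abs_mul, abs_of_nonneg (by positivity : (0 : ℝ) ≤ (Lc : ℝ) ^ (2 * (d + 1))), mul_assoc]
  exact mul_le_mul_of_nonneg_left h (by positivity)

/-- **THE ALL-SCALES CAUCHY LETTER OF THE UNIT TENT KERNEL FROM `hKall`**: `CauchyDecayK … cK θ δ` (`0 ≤ δ`) gives, for all `k, j` and every coarse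
displacement `y`, `|(Lc^{k+j+1})^{2(d+1)}·wΦ_{Lc^{k+j+1}} κ l y − (Lc^{k+1})^{2(d+1)}·wΦ_{Lc^{k+1}} κ l y| ≤ Lc^{2(d+1)}·cK·θ^k·e^{−δ|y|₁}`.
[cite: King1986, §4 p.672 (the all-scales comparison pattern)] [folklore] -/
theorem abs_unitTent_sub_le {cK θ δ : ℝ} (hKall : CauchyDecayK d Lc (sfStep Lc) (smStep d Lc) cK θ δ) (hδ : 0 ≤ δ) (k j : ℕ)
    (κ l : Fin (d + 1)) (y : Fin (d + 1) → ℤ) :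
    |(((Lc : ℝ) ^ (k + j + 1)) ^ (2 * (d + 1))) * wΦ (N := Lc ^ (k + j + 1)) κ l y
        - (((Lc : ℝ) ^ (k + 1)) ^ (2 * (d + 1))) * wΦ (N := Lc ^ (k + 1)) κ l y|
      ≤ (Lc : ℝ) ^ (2 * (d + 1)) * (cK * θ ^ k) * Real.exp (-δ * l1 y) := by
  have h := decays_E2unit_sub (hKall k j) hδ y 0 (Sum.inl κ) (Sum.inl l)
  rw [sub_zero, Pi.sub_apply, Pi.sub_apply, Pi.sub_apply, Pi.sub_apply] at h
  rw [unitTent_eq, unitTent_eq, ← mul_sub, abs_mul, abs_of_nonneg (by positivity : (0 : ℝ) ≤ (Lc : ℝ) ^ (2 * (d + 1))), mul_assoc]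
  exact mul_le_mul_of_nonneg_left h (by positivity)

/-- the partner letters' variables: `φ^{(k)}_{μ,z} κ y := wΦ_{Lc^{k+1}} κ μ (y − z)` decays from the source block `z`, level-uniformly, from `hK`. [folklore] -/
theorem abs_unitTent_transl_le {C δ : ℝ} (hK : UnitDecayK d Lc (sfStep Lc) (smStep d Lc) C δ) (hδ : 0 ≤ δ) (k : ℕ) (κ μ : Fin (d + 1))
    (y z : Fin (d + 1) → ℤ) :
    |(((Lc : ℝ) ^ (k + 1)) ^ (2 * (d + 1))) * wΦ (N := Lc ^ (k + 1)) κ μ (y - z)| ≤ (Lc : ℝ) ^ (2 * (d + 1)) * C * Real.exp (-δ * l1 (y - z)) :=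
  abs_unitTent_le hK hδ k κ μ (y - z)

/-- the partner letters' variables, ALL SCALES: the unit tents of towers `k+j` and `k` sourced at the same block `z` differ by `Lc^{2(d+1)}·cK·θ^k·e^{−δ|y−z|₁}`,
from `hKall`. [folklore] -/
theorem abs_unitTent_transl_sub_le {cK θ δ : ℝ} (hKall : CauchyDecayK d Lc (sfStep Lc) (smStep d Lc) cK θ δ) (hδ : 0 ≤ δ) (k j : ℕ)
    (κ μ : Fin (d + 1)) (y z : Fin (d + 1) → ℤ) :
    |(((Lc : ℝ) ^ (k + j + 1)) ^ (2 * (d + 1))) * wΦ (N := Lc ^ (k + j + 1)) κ μ (y - z)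
        - (((Lc : ℝ) ^ (k + 1)) ^ (2 * (d + 1))) * wΦ (N := Lc ^ (k + 1)) κ μ (y - z)|
      ≤ (Lc : ℝ) ^ (2 * (d + 1)) * (cK * θ ^ k) * Real.exp (-δ * l1 (y - z)) :=
  abs_unitTent_sub_le hKall hδ k j κ μ (y - z)

end Letters

/-! ## §3 `d = 3`: both letters UNCONDITIONAL from the K-slot -/

section Three

/-- **THE UNIT TENT KERNEL's TWO LETTERS AT `d = 3`, UNCONDITIONAL (`Lc ≥ 2`)**: there are `C, δ, cK, θ` with `0 < δ`, `0 ≤ θ < 1` such that for ALL levels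
`k`, all `j`, components `κ μ`, coarse displacements `y` and source blocks `z`:
 (i) `|(Lc^{k+1})^8·wΦ_{Lc^{k+1}} κ μ (y − z)| ≤ C·e^{−δ|y−z|₁}`;
 (ii) `|(Lc^{k+j+1})^8·wΦ_{Lc^{k+j+1}} κ μ (y − z) − (Lc^{k+1})^8·wΦ_{Lc^{k+1}} κ μ (y − z)| ≤ cK·θ^k·e^{−δ|y−z|₁}`
— `KSlotAssembly.convCKWall_holds` (the wall's `hK`∕`hKall` for the unit-normalised step resolvents) read on the mm-block through §1. [folklore] -/
theorem exists_unitTent_letters_three (hLc : 2 ≤ Lc) :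
    ∃ C δ cK θ : ℝ, 0 < δ ∧ 0 ≤ θ ∧ θ < 1 ∧
      (∀ (k : ℕ) (κ μ : Fin (3 + 1)) (y z : Fin (3 + 1) → ℤ),
        |(((Lc : ℝ) ^ (k + 1)) ^ (2 * (3 + 1))) * wΦ (N := Lc ^ (k + 1)) κ μ (y - z)| ≤ C * Real.exp (-δ * l1 (y - z))) ∧
      (∀ (k j : ℕ) (κ μ : Fin (3 + 1)) (y z : Fin (3 + 1) → ℤ),
        |(((Lc : ℝ) ^ (k + j + 1)) ^ (2 * (3 + 1))) * wΦ (N := Lc ^ (k + j + 1)) κ μ (y - z)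
            - (((Lc : ℝ) ^ (k + 1)) ^ (2 * (3 + 1))) * wΦ (N := Lc ^ (k + 1)) κ μ (y - z)|
          ≤ cK * θ ^ k * Real.exp (-δ * l1 (y - z))) := by
  obtain ⟨C, δ, cK, θ, hδ, hθ0, hθ1, hK, hKall⟩ := convCKWall_holds (Lc := Lc) hLc
  refine ⟨(Lc : ℝ) ^ (2 * (3 + 1)) * C, δ, (Lc : ℝ) ^ (2 * (3 + 1)) * cK, θ, hδ, hθ0, hθ1, fun k κ μ y z => ?_, fun k j κ μ y z => ?_⟩
  · exact abs_unitTent_transl_le hK hδ.le k κ μ y z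
  · have h := abs_unitTent_transl_sub_le hKall hδ.le k j κ μ y z
    rw [← mul_assoc] at h
    exact h

end Three

end Summit.QuantumFields.BalabanUV.Beta.GAN24.ContactTentCauchy

end
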